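import Literature.Geometry.Kaehler.ComplexTorusHodgeGeneralTimesSmallFactorIntrinsic
import Literature.Geometry.Kaehler.ComplexTorusHodgeGroupIsogenyLieInvariance
import Literature.Geometry.Kaehler.ComplexTorusHodgeGroupProductLieSimpleFactor
import Literature.Geometry.Kaehler.ComplexTorusHodgeClassesProductHodgeGroupComplexPoints
import HarnessLib

/-!
# The Hodge group of an abelian variety, INTRINSICALLY: `dim Hg(X) ≤ g(2g+1)` with equality iff `Hg(X) = Sp(V, E)` iff
# `X` is stably nondegenerate with `End_ℚ(X) = ℚ`; then `Lie Hg(X)(ℂ)` is simple and `Hg(X × X₂)(ℂ) = Hg(X)(ℂ) × Hg(X₂)(ℂ)`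
# whenever `dim Hg(X₂) < g(2g+1)` / `Hg(X₂)` solvable / `X₂` Hodge-general of another dimension; `Hg(T × S)`, `Hg(T × E_τ)`
# for every abelian threefold `T` with `End_ℚ(T) = ℚ` (Moonen–Zarhin (0.2)(4), (0.3)(4): "`Hg(X) = Hg(Y₁^{m₁}) × ⋯ × Hg(Y_r^{m_r})`")

Layer `Literature/Geometry/Kaehler`, namespace `Literature.Geometry.Kaehler.ComplexTorus`; lane `lit-hodgefound`
(Track 2, Layer A4), seat `lit-hodgefound-skel-4`, row A4-129 of `run/shared/lean/pub/lit-hodgefound/SKELETON.md`.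
THEOREMS ONLY (no `def`, no named fact, no instance, no notation; net debt `0`).

THE POINT. Rows A4-127/128 transported the (D)-currency consequences of `Hg(X₁) = Sp` to an ARBITRARY presentation of
an abelian variety `X₁` with `End_ℚ(X₁) = ℚ` and (D). This file does the same for the GROUP-THEORETIC statements — the
other half of Moonen–Zarhin's theorems ("`Hg(X) = Sp_D(V,φ)`", "`Hg(X) = Hg(Y₁^{m₁}) × ⋯ × Hg(Y_r^{m_r})`") — using p17's
isogeny invariance of the LAG dimension `dim Hg(X)` and of the simplicity of `Lie Hg(X)(ℂ)`
(`IsIsogenous.zdim_hodgeGroupC_eq`, `IsIsogenous.isSimple_lieSubalgebraGL_hodgeGroupC_iff`,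
`ComplexTorusHodgeGroupIsogenyLieInvariance`) along the isogeny `X ∼ X'` to a principal `J`-presentation of row A4-127
(`IsRiemannForm.exists_isIsogenous_ratCast_map_J_eq_latticeGram`, `IsAbelianVariety.exists_isIsogenous_J_of_endAlgRat_eq_bot`),
where the `J`-theorems (`zdim_map_toGL_hodgeGroupC_le_of_latticeGram_eq_J`, `hodgeGroupC_eq_symplecticGroupC_iff_zdim_eq`,
Gordon 7.5 `IsRiemannForm.hodgeGroupC_eq_symplecticGroupC_iff_forall_divisorClasses_eq_hodgeClasses_and_endAlgRat_eq_bot`,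
`isSimple_lieSubalgebraGL_map_toGL_hodgeGroupC_of_eq_symplecticGroupC`) apply; the product splittings are then the
presentation-free theorems of `ComplexTorusHodgeGroupProductLieSimpleFactor` (Lie-simple first factor).

* §1 **`dim Hg(X) ≤ g(2g+1)` for EVERY complex abelian variety** (`Hg(X) ⊂ Sp(V, φ)`; `IsAbelianVariety.zdim_map_toGL_hodgeGroupC_le`),
  **`dim Hg(X) = g(2g+1) ⟺ (D) on all powers ∧ End_ℚ(X) = ℚ`** (Gordon 7.5 + Lange 7.3.2, intrinsic:
  `IsAbelianVariety.zdim_map_toGL_hodgeGroupC_eq_iff`), **`Hg(X) = Sp(V, E) ⟺ dim Hg(X) = g(2g+1)`** for ANY polarisation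
  `E` of any presentation (`IsRiemannForm.hodgeGroup_eq_spGroup_iff_zdim_eq_finrank`), `dim Hg(X) = g(2g+1)` for
  Hodge-general `X`, `dim Hg(X) < g(2g+1) ⟺` (some power carries a non-divisorial Hodge class or `End_ℚ(X) ≠ ℚ`);
* §2 **`Lie Hg(X)(ℂ)` is SIMPLE for every Hodge-general abelian variety** (`= 𝔰𝔭_{2g}(ℂ)` up to the isogeny);
* §3 **`Hg(X₁ × X₂)(ℂ) = Hg(X₁)(ℂ) × Hg(X₂)(ℂ)`** (and on real points) for `X₁` Hodge-general and `dim Hg(X₂) < g₁(2g₁+1)`, or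
  `(2g₂)² ≤ g₁(2g₁+1)`, or `Hg(X₂)(ℂ)` solvable, or `X₂` Hodge-general of a different dimension (Moonen–Zarhin (3.1), Gordon
  §2.16, Hazama);
* §4 **`Hg(T × S)(ℂ) = Hg(T)(ℂ) × Hg(S)(ℂ)` and `Hg(T × E_τ)(ℂ) = Hg(T)(ℂ) × Hg(E_τ)(ℂ)`** for every abelian threefold `T` with
  `End_ℚ(T) = ℚ`, every abelian surface ∕ complex 2-torus `S` and every elliptic curve `E_τ` (Thm. (0.3)(4), (0.2)(4)), and
  `Hg(X₁ × E_τ)` for Hodge-general `X₁` of dimension `≥ 2`.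

## Sources, verbatim

* B. Moonen, Yu. G. Zarhin [held arXiv:math/9901113]: §1 [p0002 L123–L132] "The Hodge group `Hg(X)` is a connected
  reductive algebraic group … `Hg(X) ⊂ Sp_D(V,φ)`"; Thm. (0.2)(4) [p0001] "Then `Hg(X) = Sp_D(V,φ)` and `B•(Xⁿ) = D•(Xⁿ)`
  for all `n`."; Thm. (0.3)(4) [p0002 L1–L7] "Decompose `X`, up to isogeny, … `X ∼ Y₁^{m₁} × ⋯ × Y_r^{m_r}`. Then
  `Hg(X) = Hg(Y₁^{m₁}) × ⋯ Hg(Y_r^{m_r})` … if `X` has no simple factor of dimension 4 then `Hg(X) = Sp_D(V,φ)`";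
  §3 (3.1) [p0006 L52–L60], Thm. (3.2).
* H. Lange, *Abelian Varieties over the Complex Numbers* (2023): §7.2.1 Prop. 7.2.3 (`Hg(X) ⊆ Sp(V, E)`), §7.3.1 Prop. 7.3.2
  and its proof (pp. 337–338: "`𝔥𝔤(X_J)` is a proper Lie subalgebra of `𝔰𝔭(V, E)` … lower-dimensional"), §2.1.1 Prop. 2.1.2.
* B. B. Gordon, survey (1997/1999), §2.16 Proposition, Thm. 6.2, Thm. 7.5; T. A. Springer, *Linear Algebraic Groups*,
  1.8.2, 4.4.6, 7.4.7 (3)(b), (5); B. van Geemen, LNM 1594, 3.6 (isogeny invariance of `Hg`).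

## References

* [MoonenZarhin1999LowDim] B. Moonen, Yu. G. Zarhin, Math. Ann. 315 (1999) 711–733, Thm. (0.2), (0.3), §1, §3 (3.1), (3.2).
* [Lange2023AbelianVarietiesComplex] H. Lange, Springer (2023), §7.2.1 Prop. 7.2.3, §7.3.1 Prop. 7.3.2, §2.1.1 Prop. 2.1.2.
* [Gordon1999HodgeAVSurvey] B. B. Gordon, in J. D. Lewis, *A Survey of the Hodge Conjecture* (1999), Thm. 6.2, 7.5.
* [Gordon1997] B. B. Gordon, arXiv:alg-geom/9709030, §2.16 Proposition.
* [Springer1998] T. A. Springer, *Linear Algebraic Groups*, 2nd ed. (1998), 1.8.2, 4.4.6, 7.4.7.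
* [vanGeemen1994HodgeAV] B. van Geemen, LNM 1594 (1994), 3.6.
-/

noncomputable section

open Module Matrix Set Function
open Literature.NumberTheory.Automorphic (IsZConnected lieAlgebraGL lieSubalgebraGL)

namespace Literature.Geometry.Kaehler

namespace ComplexTorus

/-- A complex torus of positive dimension has a non-empty lattice index type. [cite: Lange2023AbelianVarietiesComplex, §1.1.2 (p. 18)] -/
private theorem nonempty_of_finrank_pos₁₂₉ {ι : Type*} [Fintype ι] {E : Type*} [NormedAddCommGroup E] [NormedSpace ℂ E]
    [FiniteDimensional ℂ E] (Φ : (ι → ℝ) ≃L[ℝ] E) (h : 0 < finrank ℂ E) : Nonempty ι := by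
  have hc := card_eq_two_mul_finrank Φ
  exact Fintype.card_pos_iff.1 (by omega)

/-- `dim Hg(X₂) < N` as soon as `(2g₂)² ≤ N` (`dim Hg(X₂) ≤ (2g₂)² − 1`). [cite: MoonenZarhin1999LowDim, §1 (p0002 L129)] -/
private theorem zdim_lt_of_card_sq_le₁₂₉ {ι₂ : Type*} [Fintype ι₂] [DecidableEq ι₂] [Nonempty ι₂] {E₂ : Type*}
    [NormedAddCommGroup E₂] [NormedSpace ℂ E₂] (Φ₂ : (ι₂ → ℝ) ≃L[ℝ] E₂) {N : ℕ} (hcard : Fintype.card ι₂ ^ 2 ≤ N) :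
    (isZConnected_map_toGL_hodgeGroupC Φ₂).zdim < N := by
  have h1 := zdim_map_toGL_hodgeGroupC_le Φ₂
  have h2 : 0 < Fintype.card ι₂ := Fintype.card_pos
  have h3 : 0 < Fintype.card ι₂ ^ 2 := pow_pos h2 2
  omega

/-- `(2·2)² = 16 ≤ 21 = 3·7` (any universes). [folklore] [cite: Lange2023AbelianVarietiesComplex, §1.1.2 (p. 18)] -/
private theorem card_sq_le_of_two_three₁₂₉ {ι₂ : Type*} [Fintype ι₂] {E₁ E₂ : Type*} [NormedAddCommGroup E₁]
    [NormedSpace ℂ E₁] [NormedAddCommGroup E₂] [NormedSpace ℂ E₂] [FiniteDimensional ℂ E₂] (Φ₂ : (ι₂ → ℝ) ≃L[ℝ] E₂)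
    (h2 : finrank ℂ E₂ = 2) (h3 : finrank ℂ E₁ = 3) : Fintype.card ι₂ ^ 2 ≤ finrank ℂ E₁ * (2 * finrank ℂ E₁ + 1) := by
  have h := card_eq_two_mul_finrank Φ₂
  rw [h2] at h
  rw [h, h3]
  norm_num

/-! ## §1 `dim Hg(X) ≤ g(2g+1)`, with equality iff `Hg(X) = Sp(V, E)` iff `X` is Hodge-general -/

section Dimension

variable {ι : Type*} [Fintype ι] [DecidableEq ι] {E : Type*} [NormedAddCommGroup E] [NormedSpace ℂ E]
  [FiniteDimensional ℂ E] (Φ : (ι → ℝ) ≃L[ℝ] E) {η : E [⋀^Fin 2]→L[ℝ] ℝ}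

/-- **`dim Hg(X) ≤ g(2g+1)` for every polarised complex torus** (`Hg(X) ⊂ Sp(V, φ)`, a group of dimension `g(2g+1)`;
intrinsic: any presentation, `g = dim_ℂ E`). [cite: MoonenZarhin1999LowDim, §1 (p0002 L129: "`Hg(X) ⊂ Sp_D(V,φ)`")]
[cite: Lange2023AbelianVarietiesComplex, §7.2.1 Prop. 7.2.3] [cite: Springer1998, 7.4.7 (5) and 1.8.2] -/
theorem IsRiemannForm.zdim_map_toGL_hodgeGroupC_le_finrank (hη : IsRiemannForm Φ η) :
    (isZConnected_map_toGL_hodgeGroupC Φ).zdim ≤ finrank ℂ E * (2 * finrank ℂ E + 1) := by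
  obtain ⟨g, Ψ, hiso, -, hΨ, hG, hg⟩ := hη.exists_isIsogenous_ratCast_map_J_eq_latticeGram Φ
  rw [hiso.zdim_hodgeGroupC_eq, hg]
  have h := zdim_map_toGL_hodgeGroupC_le_of_latticeGram_eq_J Ψ (ofRealForm_mem_hodgeClasses_one_of_isRiemannForm Ψ hΨ) hG
  rwa [Fintype.card_fin] at h

/-- **`dim Hg(X) ≤ g(2g+1)` for every complex abelian variety `X` of dimension `g`.**
[cite: MoonenZarhin1999LowDim, §1 (p0002 L129)] [cite: Lange2023AbelianVarietiesComplex, §7.2.1 Prop. 7.2.3] -/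
theorem IsAbelianVariety.zdim_map_toGL_hodgeGroupC_le (hX : IsAbelianVariety Φ) :
    (isZConnected_map_toGL_hodgeGroupC Φ).zdim ≤ finrank ℂ E * (2 * finrank ℂ E + 1) := by
  obtain ⟨η, hη⟩ := hX
  exact hη.zdim_map_toGL_hodgeGroupC_le_finrank Φ

/-- **GORDON 7.5 WITH LANGE 7.3.2, INTRINSIC: `dim Hg(X) = g(2g+1) ⟺ (X is stably nondegenerate and End_ℚ(X) = ℚ)`** for
every polarised complex torus (the `J`-model `X' ∼ X` of row A4-127 has the same `dim Hg`, the same (D)-status and the same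
`End_ℚ`-status). [cite: Gordon1999HodgeAVSurvey, Thm. 7.5 ((1) ⟺ (2)) and Thm. 6.2] [cite: Lange2023AbelianVarietiesComplex, §7.3.1 Prop. 7.3.2 (proof, pp. 337–338)]
[cite: vanGeemen1994HodgeAV, 3.6] -/
theorem IsRiemannForm.zdim_map_toGL_hodgeGroupC_eq_iff [Nonempty ι] (hη : IsRiemannForm Φ η) :
    (isZConnected_map_toGL_hodgeGroupC Φ).zdim = finrank ℂ E * (2 * finrank ℂ E + 1) ↔
      (∀ k p : ℕ, divisorClasses (powPeriod Φ k) p = hodgeClasses (powPeriod Φ k) p) ∧ endAlgRat Φ = ⊥ := by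
  obtain ⟨g, Ψ, hiso, -, hΨ, hG, hg⟩ := hη.exists_isIsogenous_ratCast_map_J_eq_latticeGram Φ
  have hmem := ofRealForm_mem_hodgeClasses_one_of_isRiemannForm Ψ hΨ
  rw [hiso.zdim_hodgeGroupC_eq, hg, hiso.forall_powPeriod_divisorClasses_eq_hodgeClasses_iff, hiso.endAlgRat_eq_bot_iff,
    ← hΨ.hodgeGroupC_eq_symplecticGroupC_iff_forall_divisorClasses_eq_hodgeClasses_and_endAlgRat_eq_bot hG,
    hodgeGroupC_eq_symplecticGroupC_iff_zdim_eq Ψ hmem hG, Fintype.card_fin]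

/-- The same from `IsAbelianVariety`. [cite: Gordon1999HodgeAVSurvey, Thm. 7.5 and Thm. 6.2] [cite: Lange2023AbelianVarietiesComplex, §7.3.1 Prop. 7.3.2] -/
theorem IsAbelianVariety.zdim_map_toGL_hodgeGroupC_eq_iff [Nonempty ι] (hX : IsAbelianVariety Φ) :
    (isZConnected_map_toGL_hodgeGroupC Φ).zdim = finrank ℂ E * (2 * finrank ℂ E + 1) ↔
      (∀ k p : ℕ, divisorClasses (powPeriod Φ k) p = hodgeClasses (powPeriod Φ k) p) ∧ endAlgRat Φ = ⊥ := by
  obtain ⟨η, hη⟩ := hX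
  exact hη.zdim_map_toGL_hodgeGroupC_eq_iff Φ

/-- **`Hg(X) = Sp(V, E) ⟺ dim Hg(X) = g(2g+1)`, for ANY polarisation `E` of ANY presentation** (Lange Prop. 7.3.2, proof:
`Hg(X) ≠ Sp(V, E)` iff `𝔥𝔤` is "lower-dimensional"). [cite: Lange2023AbelianVarietiesComplex, §7.3.1 Prop. 7.3.2 (proof, pp. 337–338)]
[cite: Springer1998, 1.8.2 and 7.4.7 (5)] [cite: Gordon1999HodgeAVSurvey, Thm. 7.5] -/
theorem IsRiemannForm.hodgeGroup_eq_spGroup_iff_zdim_eq_finrank [Nonempty ι] (hη : IsRiemannForm Φ η) :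
    hodgeGroup Φ = spGroup Φ η ↔ (isZConnected_map_toGL_hodgeGroupC Φ).zdim = finrank ℂ E * (2 * finrank ℂ E + 1) := by
  rw [hη.hodgeGroup_eq_spGroup_iff_forall_divisorClasses_eq_hodgeClasses_and_endAlgRat_eq_bot,
    hη.zdim_map_toGL_hodgeGroupC_eq_iff Φ]

/-- `Hg(X) ≠ Sp(V, E) ⟺ dim Hg(X) < g(2g+1)` ("`𝔥𝔤(X_J)` is a proper Lie subalgebra of `𝔰𝔭(V, E)` … lower-dimensional").
[cite: Lange2023AbelianVarietiesComplex, §7.3.1 Prop. 7.3.2 (proof, pp. 337–338)] [cite: Springer1998, 1.8.2] -/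
theorem IsRiemannForm.hodgeGroup_ne_spGroup_iff_zdim_lt_finrank [Nonempty ι] (hη : IsRiemannForm Φ η) :
    hodgeGroup Φ ≠ spGroup Φ η ↔ (isZConnected_map_toGL_hodgeGroupC Φ).zdim < finrank ℂ E * (2 * finrank ℂ E + 1) := by
  rw [Ne, hη.hodgeGroup_eq_spGroup_iff_zdim_eq_finrank Φ]
  have h := hη.zdim_map_toGL_hodgeGroupC_le_finrank Φ
  constructor
  · intro h'; omega
  · intro h'; omega

/-- **A Hodge-general abelian variety has `dim Hg(X) = g(2g+1)`** (`End_ℚ(X) = ℚ` and (D) on all powers; any presentation).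
[cite: Gordon1999HodgeAVSurvey, Thm. 7.5 ((1) ⟹ (2))] [cite: Lange2023AbelianVarietiesComplex, §7.3.1 Prop. 7.3.2] -/
theorem IsAbelianVariety.zdim_map_toGL_hodgeGroupC_eq_of_endAlgRat_eq_bot [Nonempty ι] (hX : IsAbelianVariety Φ)
    (hE : endAlgRat Φ = ⊥) (hD : ∀ k p : ℕ, divisorClasses (powPeriod Φ k) p = hodgeClasses (powPeriod Φ k) p) :
    (isZConnected_map_toGL_hodgeGroupC Φ).zdim = finrank ℂ E * (2 * finrank ℂ E + 1) :=
  (hX.zdim_map_toGL_hodgeGroupC_eq_iff Φ).2 ⟨hD, hE⟩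

/-- `Hg(X) = Sp(V, E)` (real points, any polarisation) ⟹ `dim Hg(X) = g(2g+1)`. [cite: Lange2023AbelianVarietiesComplex, §7.3.1 Prop. 7.3.2]
[cite: Springer1998, 7.4.7 (5)] -/
theorem IsRiemannForm.zdim_map_toGL_hodgeGroupC_eq_of_hodgeGroup_eq_spGroup [Nonempty ι] (hη : IsRiemannForm Φ η)
    (h : hodgeGroup Φ = spGroup Φ η) : (isZConnected_map_toGL_hodgeGroupC Φ).zdim = finrank ℂ E * (2 * finrank ℂ E + 1) :=
  (hη.hodgeGroup_eq_spGroup_iff_zdim_eq_finrank Φ).1 h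

/-- **`dim Hg(X) < g(2g+1) ⟺` (some power `Xᵏ` carries a Hodge class not generated by divisor classes, or
`End_ℚ(X) ≠ ℚ`)** — the abelian varieties with "small" Hodge group are exactly the non-Hodge-general ones.
[cite: Gordon1999HodgeAVSurvey, Thm. 7.5] [cite: Lange2023AbelianVarietiesComplex, §7.3.1 Prop. 7.3.2 (proof)] -/
theorem IsAbelianVariety.zdim_map_toGL_hodgeGroupC_lt_iff [Nonempty ι] (hX : IsAbelianVariety Φ) :
    (isZConnected_map_toGL_hodgeGroupC Φ).zdim < finrank ℂ E * (2 * finrank ℂ E + 1) ↔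
      (∃ k p : ℕ, divisorClasses (powPeriod Φ k) p ≠ hodgeClasses (powPeriod Φ k) p) ∨ endAlgRat Φ ≠ ⊥ := by
  have hle := hX.zdim_map_toGL_hodgeGroupC_le Φ
  have hiff := hX.zdim_map_toGL_hodgeGroupC_eq_iff Φ
  constructor
  · intro hlt
    by_contra h
    push Not at h
    exact absurd (hiff.2 ⟨h.1, h.2⟩) (Nat.ne_of_lt hlt)
  · intro h
    rcases Nat.lt_or_ge (isZConnected_map_toGL_hodgeGroupC Φ).zdim (finrank ℂ E * (2 * finrank ℂ E + 1)) with hlt | hge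
    · exact hlt
    · exfalso
      obtain ⟨hD, hE⟩ := hiff.1 (le_antisymm hle hge)
      rcases h with ⟨k, p, hkp⟩ | hE'
      · exact hkp (hD k p)
      · exact hE' hE

/-- **An abelian variety with `End_ℚ(X) = ℚ` but `dim Hg(X) < g(2g+1)` carries an exceptional Hodge class on some power**
(contrapositive of Gordon 7.5 (1) ⟹ (2); e.g. Mumford's fourfolds). [cite: Gordon1999HodgeAVSurvey, Thm. 7.5 and 8.1]
[cite: MoonenZarhin1999LowDim, Thm. (0.2) (3)] -/
theorem IsAbelianVariety.exists_divisorClasses_ne_hodgeClasses_of_zdim_lt [Nonempty ι] (hX : IsAbelianVariety Φ)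
    (hE : endAlgRat Φ = ⊥) (hlt : (isZConnected_map_toGL_hodgeGroupC Φ).zdim < finrank ℂ E * (2 * finrank ℂ E + 1)) :
    ∃ k p : ℕ, divisorClasses (powPeriod Φ k) p ≠ hodgeClasses (powPeriod Φ k) p := by
  rcases (hX.zdim_map_toGL_hodgeGroupC_lt_iff Φ).1 hlt with h | h
  · exact h
  · exact absurd hE h

end Dimension

/-! ## §2 `Lie Hg(X)(ℂ)` is simple for every Hodge-general abelian variety -/

section Simple

variable {ι : Type*} [Fintype ι] [DecidableEq ι] [Nonempty ι] {E : Type*} [NormedAddCommGroup E] [NormedSpace ℂ E]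
  [FiniteDimensional ℂ E] (Φ : (ι → ℝ) ≃L[ℝ] E) {η : E [⋀^Fin 2]→L[ℝ] ℝ}

/-- **`Lie Hg(X)(ℂ)` IS SIMPLE for every abelian variety `X` with `End_ℚ(X) = ℚ` and (D) on all powers** (any
presentation: `X ∼ X'` a principal `J`-presentation with `Hg(X')(ℂ) = Sp_{2g}(ℂ)`, `𝔰𝔭_{2g}` simple, and simplicity of
`Lie Hg(ℂ)` is an isogeny invariant). [cite: Gordon1999HodgeAVSurvey, Thm. 7.5 ((1) ⟹ (2))] [cite: Springer1998, 7.4.7 (3)(b)]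
[cite: vanGeemen1994HodgeAV, 3.6] [cite: MoonenZarhin1999LowDim, (0.2)(4)] -/
theorem IsAbelianVariety.isSimple_lieSubalgebraGL_map_toGL_hodgeGroupC_of_endAlgRat_eq_bot (hX : IsAbelianVariety Φ)
    (hE : endAlgRat Φ = ⊥) (hD : ∀ k p : ℕ, divisorClasses (powPeriod Φ k) p = hodgeClasses (powPeriod Φ k) p) :
    LieAlgebra.IsSimple ℂ (lieSubalgebraGL ((hodgeGroupC Φ).map Matrix.SpecialLinearGroup.toGL)) := by
  obtain ⟨g, Ψ, η', hiso, hp, hG, hg, hg0, hEΨ, hDΨ⟩ := hX.exists_isIsogenous_J_of_endAlgRat_eq_bot Φ hE hD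
  haveI : Nonempty (Fin g) := ⟨⟨0, hg0⟩⟩
  exact hiso.isSimple_lieSubalgebraGL_hodgeGroupC_iff.2
    (isSimple_lieSubalgebraGL_map_toGL_hodgeGroupC_of_eq_symplecticGroupC Ψ
      (hp.isRiemannForm.hodgeGroupC_eq_symplecticGroupC_of_forall_divisorClasses_eq_hodgeClasses hG hEΨ hDΨ))

/-- **`Hg(X) = Sp(V, E)` (real points, ANY polarisation of any presentation) ⟹ `Lie Hg(X)(ℂ)` is simple** (presentation-free
form of `IsRiemannForm.isSimple_lieSubalgebraGL_map_toGL_hodgeGroupC_of_hodgeGroup_eq_spGroup`).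
[cite: Lange2023AbelianVarietiesComplex, §7.3.1 Prop. 7.3.2] [cite: Springer1998, 7.4.7 (3)(b)] [cite: Gordon1999HodgeAVSurvey, Thm. 7.5] -/
theorem IsRiemannForm.isSimple_lieSubalgebraGL_map_toGL_hodgeGroupC_of_hodgeGroup_eq_spGroup' (hη : IsRiemannForm Φ η)
    (h : hodgeGroup Φ = spGroup Φ η) :
    LieAlgebra.IsSimple ℂ (lieSubalgebraGL ((hodgeGroupC Φ).map Matrix.SpecialLinearGroup.toGL)) := by
  have h' := (hη.hodgeGroup_eq_spGroup_iff_forall_divisorClasses_eq_hodgeClasses_and_endAlgRat_eq_bot).1 h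
  exact IsAbelianVariety.isSimple_lieSubalgebraGL_map_toGL_hodgeGroupC_of_endAlgRat_eq_bot Φ ⟨η, hη⟩ h'.2 h'.1

/-- `dim Hg(X) = g(2g+1)` ⟹ `Lie Hg(X)(ℂ)` is simple (abelian variety `X`). [cite: Lange2023AbelianVarietiesComplex, §7.3.1 Prop. 7.3.2]
[cite: Springer1998, 7.4.7 (3)(b) and 1.8.2] -/
theorem IsAbelianVariety.isSimple_lieSubalgebraGL_map_toGL_hodgeGroupC_of_zdim_eq (hX : IsAbelianVariety Φ)
    (h : (isZConnected_map_toGL_hodgeGroupC Φ).zdim = finrank ℂ E * (2 * finrank ℂ E + 1)) :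
    LieAlgebra.IsSimple ℂ (lieSubalgebraGL ((hodgeGroupC Φ).map Matrix.SpecialLinearGroup.toGL)) := by
  obtain ⟨hD, hE⟩ := (hX.zdim_map_toGL_hodgeGroupC_eq_iff Φ).1 h
  exact hX.isSimple_lieSubalgebraGL_map_toGL_hodgeGroupC_of_endAlgRat_eq_bot Φ hE hD

end Simple

/-! ## §3 The Hodge group of `X₁ × X₂` splits for Hodge-general `X₁` and a small / solvable / other-dimensional `X₂` -/

section Product

variable {ι₁ ι₂ : Type*} [Fintype ι₁] [DecidableEq ι₁] [Nonempty ι₁] [Fintype ι₂] [DecidableEq ι₂]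
  {E₁ E₂ : Type*} [NormedAddCommGroup E₁] [NormedSpace ℂ E₁] [FiniteDimensional ℂ E₁] [NormedAddCommGroup E₂]
  [NormedSpace ℂ E₂] {Φ₁ : (ι₁ → ℝ) ≃L[ℝ] E₁} (Φ₂ : (ι₂ → ℝ) ≃L[ℝ] E₂)

/-- **MOONEN–ZARHIN (3.1) / GORDON §2.16, INTRINSIC: `X₁` ANY abelian variety with `End_ℚ(X₁) = ℚ` and (D) on all powers,
`X₂` any complex torus with `dim Hg(X₂) < g₁(2g₁+1)` ⟹ `Hg(X₁ × X₂)(ℂ) = Hg(X₁)(ℂ) × Hg(X₂)(ℂ)`** (`Lie Hg(X₁)(ℂ)` is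
simple of dimension `g₁(2g₁+1) > dim Hg(X₂)`: Goursat). [cite: MoonenZarhin1999LowDim, §3 (3.1) (p0006 L52–L60)]
[cite: Gordon1997, §2.16 Proposition] [cite: Lange2023AbelianVarietiesComplex, §7.3.1 Prop. 7.3.2] -/
theorem IsAbelianVariety.hodgeGroupC_prod_eq_blockDiagProd_of_endAlgRat_eq_bot_of_zdim_lt (hA₁ : IsAbelianVariety Φ₁)
    (hE₁ : endAlgRat Φ₁ = ⊥) (hX₁ : ∀ k p, divisorClasses (powPeriod Φ₁ k) p = hodgeClasses (powPeriod Φ₁ k) p)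
    (hlt : (isZConnected_map_toGL_hodgeGroupC Φ₂).zdim < finrank ℂ E₁ * (2 * finrank ℂ E₁ + 1)) :
    hodgeGroupC (prodPeriod Φ₁ Φ₂) = blockDiagProd (hodgeGroupC Φ₁) (hodgeGroupC Φ₂) :=
  hodgeGroupC_prod_eq_blockDiagProd_of_isSimple_lieSubalgebraGL_of_zdim_lt Φ₁ Φ₂
    (hA₁.isSimple_lieSubalgebraGL_map_toGL_hodgeGroupC_of_endAlgRat_eq_bot Φ₁ hE₁ hX₁)
    (by rwa [hA₁.zdim_map_toGL_hodgeGroupC_eq_of_endAlgRat_eq_bot Φ₁ hE₁ hX₁])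

/-- **The numerical form `(2g₂)² ≤ g₁(2g₁+1)`.** [cite: MoonenZarhin1999LowDim, §3 (3.1) and §1 (p0002 L129)] [cite: Gordon1997, §2.16 Proposition] -/
theorem IsAbelianVariety.hodgeGroupC_prod_eq_blockDiagProd_of_endAlgRat_eq_bot_of_card_sq_le [Nonempty ι₂]
    (hA₁ : IsAbelianVariety Φ₁) (hE₁ : endAlgRat Φ₁ = ⊥)
    (hX₁ : ∀ k p, divisorClasses (powPeriod Φ₁ k) p = hodgeClasses (powPeriod Φ₁ k) p)
    (hcard : Fintype.card ι₂ ^ 2 ≤ finrank ℂ E₁ * (2 * finrank ℂ E₁ + 1)) :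
    hodgeGroupC (prodPeriod Φ₁ Φ₂) = blockDiagProd (hodgeGroupC Φ₁) (hodgeGroupC Φ₂) :=
  hA₁.hodgeGroupC_prod_eq_blockDiagProd_of_endAlgRat_eq_bot_of_zdim_lt Φ₂ hE₁ hX₁ (zdim_lt_of_card_sq_le₁₂₉ Φ₂ hcard)

/-- **`Hg(X₁) = Sp(V, E)` form** (real points, any polarisation of any presentation of `X₁`).
[cite: MoonenZarhin1999LowDim, §3 (3.1)] [cite: Gordon1997, §2.16 Proposition] [cite: Lange2023AbelianVarietiesComplex, §7.3.1 Prop. 7.3.2] -/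
theorem IsRiemannForm.hodgeGroupC_prod_eq_blockDiagProd_of_hodgeGroup_eq_spGroup_of_zdim_lt' {η₁ : E₁ [⋀^Fin 2]→L[ℝ] ℝ}
    (hη₁ : IsRiemannForm Φ₁ η₁) (h₁ : hodgeGroup Φ₁ = spGroup Φ₁ η₁)
    (hlt : (isZConnected_map_toGL_hodgeGroupC Φ₂).zdim < finrank ℂ E₁ * (2 * finrank ℂ E₁ + 1)) :
    hodgeGroupC (prodPeriod Φ₁ Φ₂) = blockDiagProd (hodgeGroupC Φ₁) (hodgeGroupC Φ₂) := by
  have h := (hη₁.hodgeGroup_eq_spGroup_iff_forall_divisorClasses_eq_hodgeClasses_and_endAlgRat_eq_bot).1 h₁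
  exact IsAbelianVariety.hodgeGroupC_prod_eq_blockDiagProd_of_endAlgRat_eq_bot_of_zdim_lt Φ₂ ⟨η₁, hη₁⟩ h.2 h.1 hlt

/-- **GORDON'S LEMMA, INTRINSIC: `X₁` Hodge-general, `Hg(X₂)(ℂ)` solvable ⟹ `Hg(X₁ × X₂)(ℂ) = Hg(X₁)(ℂ) × Hg(X₂)(ℂ)`** (e.g.
`X₂` of CM type). [cite: Gordon1997, §2.16 Proposition and §3 Theorem, proof] [cite: MoonenZarhin1999LowDim, §3 Theorem (2)] -/
theorem IsAbelianVariety.hodgeGroupC_prod_eq_blockDiagProd_of_endAlgRat_eq_bot_of_isSolvable (hA₁ : IsAbelianVariety Φ₁)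
    (hE₁ : endAlgRat Φ₁ = ⊥) (hX₁ : ∀ k p, divisorClasses (powPeriod Φ₁ k) p = hodgeClasses (powPeriod Φ₁ k) p)
    (h₂ : IsSolvable ↥(hodgeGroupC Φ₂)) :
    hodgeGroupC (prodPeriod Φ₁ Φ₂) = blockDiagProd (hodgeGroupC Φ₁) (hodgeGroupC Φ₂) :=
  hodgeGroupC_prod_eq_blockDiagProd_of_isSimple_lieSubalgebraGL_of_isSolvable Φ₁ Φ₂
    (hA₁.isSimple_lieSubalgebraGL_map_toGL_hodgeGroupC_of_endAlgRat_eq_bot Φ₁ hE₁ hX₁) h₂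

/-- The mirror: `Hg(X₂)(ℂ)` solvable FIRST factor, Hodge-general `X₁` second: `Hg(X₂ × X₁)(ℂ) = Hg(X₂)(ℂ) × Hg(X₁)(ℂ)`.
[cite: Gordon1997, §2.16 Proposition and §3 Theorem, proof] [cite: MoonenZarhin1999LowDim, §3 Theorem (2)] -/
theorem IsAbelianVariety.hodgeGroupC_prod_eq_blockDiagProd_of_isSolvable_of_endAlgRat_eq_bot (hA₁ : IsAbelianVariety Φ₁)
    (hE₁ : endAlgRat Φ₁ = ⊥) (hX₁ : ∀ k p, divisorClasses (powPeriod Φ₁ k) p = hodgeClasses (powPeriod Φ₁ k) p)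
    (h₂ : IsSolvable ↥(hodgeGroupC Φ₂)) :
    hodgeGroupC (prodPeriod Φ₂ Φ₁) = blockDiagProd (hodgeGroupC Φ₂) (hodgeGroupC Φ₁) :=
  hodgeGroupC_prod_eq_blockDiagProd_of_isSolvable_of_isSimple_lieSubalgebraGL Φ₂ Φ₁ h₂
    (hA₁.isSimple_lieSubalgebraGL_map_toGL_hodgeGroupC_of_endAlgRat_eq_bot Φ₁ hE₁ hX₁)

/-- `X₁` Hodge-general, `(Hg(X₂), Hg(X₂))(ℂ) = 1` (commutative Hodge group, e.g. CM type) ⟹ split.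
[cite: Gordon1997, §3 Theorem, proof] [cite: MoonenZarhin1999LowDim, §3 Theorem (2)] -/
theorem IsAbelianVariety.hodgeGroupC_prod_eq_blockDiagProd_of_endAlgRat_eq_bot_of_commutator_eq_bot
    (hA₁ : IsAbelianVariety Φ₁) (hE₁ : endAlgRat Φ₁ = ⊥)
    (hX₁ : ∀ k p, divisorClasses (powPeriod Φ₁ k) p = hodgeClasses (powPeriod Φ₁ k) p)
    (h₂ : ⁅hodgeGroupC Φ₂, hodgeGroupC Φ₂⁆ = ⊥) :
    hodgeGroupC (prodPeriod Φ₁ Φ₂) = blockDiagProd (hodgeGroupC Φ₁) (hodgeGroupC Φ₂) :=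
  hodgeGroupC_prod_eq_blockDiagProd_of_isSimple_lieSubalgebraGL_of_commutator_eq_bot Φ₁ Φ₂
    (hA₁.isSimple_lieSubalgebraGL_map_toGL_hodgeGroupC_of_endAlgRat_eq_bot Φ₁ hE₁ hX₁) h₂

/-- **Real points: `Hg(X₁ × X₂)(ℝ) = Hg(X₁)(ℝ) × Hg(X₂)(ℝ)`** under `dim Hg(X₂) < g₁(2g₁+1)`, `X₁` Hodge-general.
[cite: MoonenZarhin1999LowDim, §3 (3.1)] [cite: Gordon1997, §2.16 Proposition] [cite: Springer1998, §13.3 Cor. 13.3.9 (ii)] -/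
theorem IsAbelianVariety.hodgeGroup_prod_eq_of_endAlgRat_eq_bot_of_zdim_lt (hA₁ : IsAbelianVariety Φ₁)
    (hE₁ : endAlgRat Φ₁ = ⊥) (hX₁ : ∀ k p, divisorClasses (powPeriod Φ₁ k) p = hodgeClasses (powPeriod Φ₁ k) p)
    (hlt : (isZConnected_map_toGL_hodgeGroupC Φ₂).zdim < finrank ℂ E₁ * (2 * finrank ℂ E₁ + 1)) :
    hodgeGroup (prodPeriod Φ₁ Φ₂) = ((hodgeGroup Φ₁).prod (hodgeGroup Φ₂)).map (blockDiag ι₁ ι₂) :=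
  hodgeGroup_prod_eq_of_hodgeGroupC_prod_eq
    (hA₁.hodgeGroupC_prod_eq_blockDiagProd_of_endAlgRat_eq_bot_of_zdim_lt Φ₂ hE₁ hX₁ hlt)

variable {Φ₂} [Nonempty ι₂] [FiniteDimensional ℂ E₂] in
/-- **TWO HODGE-GENERAL ABELIAN VARIETIES OF DIFFERENT DIMENSIONS: `Hg(X₁ × X₂)(ℂ) = Hg(X₁)(ℂ) × Hg(X₂)(ℂ)`**
(`𝔰𝔭_{2g₁} ≇ 𝔰𝔭_{2g₂}`; by the dimension route, the larger factor being Lie-simple).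
[cite: MoonenZarhin1999LowDim, §3 (3.1)] [cite: Gordon1997, §2.16 Proposition] [cite: Springer1998, 7.4.7 (3)(b) and 5.3.2 (ii)] -/
theorem IsAbelianVariety.hodgeGroupC_prod_eq_blockDiagProd_of_endAlgRat_eq_bot_of_finrank_ne (hA₁ : IsAbelianVariety Φ₁)
    (hA₂ : IsAbelianVariety Φ₂) (hE₁ : endAlgRat Φ₁ = ⊥) (hE₂ : endAlgRat Φ₂ = ⊥)
    (hX₁ : ∀ k p, divisorClasses (powPeriod Φ₁ k) p = hodgeClasses (powPeriod Φ₁ k) p)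
    (hX₂ : ∀ k p, divisorClasses (powPeriod Φ₂ k) p = hodgeClasses (powPeriod Φ₂ k) p)
    (hne : finrank ℂ E₁ ≠ finrank ℂ E₂) :
    hodgeGroupC (prodPeriod Φ₁ Φ₂) = blockDiagProd (hodgeGroupC Φ₁) (hodgeGroupC Φ₂) := by
  have hz₁ := hA₁.zdim_map_toGL_hodgeGroupC_eq_of_endAlgRat_eq_bot Φ₁ hE₁ hX₁
  have hz₂ := hA₂.zdim_map_toGL_hodgeGroupC_eq_of_endAlgRat_eq_bot Φ₂ hE₂ hX₂
  rcases Nat.lt_or_gt_of_ne hne with hlt | hlt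
  · refine hodgeGroupC_prod_eq_blockDiagProd_of_isSimple_lieSubalgebraGL_right_of_zdim_lt Φ₁ Φ₂
      (hA₂.isSimple_lieSubalgebraGL_map_toGL_hodgeGroupC_of_endAlgRat_eq_bot Φ₂ hE₂ hX₂) ?_
    rw [hz₁, hz₂]
    nlinarith
  · refine hodgeGroupC_prod_eq_blockDiagProd_of_isSimple_lieSubalgebraGL_of_zdim_lt Φ₁ Φ₂
      (hA₁.isSimple_lieSubalgebraGL_map_toGL_hodgeGroupC_of_endAlgRat_eq_bot Φ₁ hE₁ hX₁) ?_
    rw [hz₁, hz₂]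
    nlinarith

end Product

/-! ## §4 `Hg(T × S)`, `Hg(T × E_τ)` for every abelian threefold `T` with `End_ℚ(T) = ℚ` (Moonen–Zarhin (0.3)(4), (0.2)(4)) -/

section Threefold

variable {ι₁ ι₂ : Type*} [Fintype ι₁] [DecidableEq ι₁] [Fintype ι₂] [DecidableEq ι₂]
  {E₁ E₂ : Type*} [NormedAddCommGroup E₁] [NormedSpace ℂ E₁] [FiniteDimensional ℂ E₁] [NormedAddCommGroup E₂]
  [NormedSpace ℂ E₂] [FiniteDimensional ℂ E₂] {Φ₁ : (ι₁ → ℝ) ≃L[ℝ] E₁} (Φ₂ : (ι₂ → ℝ) ≃L[ℝ] E₂)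

/-- **`Hg(T × S)(ℂ) = Hg(T)(ℂ) × Hg(S)(ℂ)` for every abelian threefold `T` with `End_ℚ(T) = ℚ` and every complex torus `S` of
dimension `2`** (`Hg(T) = Sp₆` by Moonen–Zarhin (2.3), `g = 3`, `End_ℚ = ℚ`; `dim Hg(S) ≤ 15 < 21`) — the Hodge-group half of
Thm. (0.3)(4) for these fivefolds. [cite: MoonenZarhin1999LowDim, Thm. (0.3) (4) (p0002 L1–L7), §2 (2.3) and §3 (3.1)]
[cite: Gordon1997, §2.16 Proposition] [cite: Lange2023AbelianVarietiesComplex, §7.3.1 Prop. 7.3.2] -/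
theorem IsAbelianVariety.hodgeGroupC_prod_eq_blockDiagProd_of_finrank_eq_three_of_endAlgRat_eq_bot_of_finrank_eq_two
    (hT : IsAbelianVariety Φ₁) (h3 : finrank ℂ E₁ = 3) (hE₁ : endAlgRat Φ₁ = ⊥) (h2 : finrank ℂ E₂ = 2) :
    hodgeGroupC (prodPeriod Φ₁ Φ₂) = blockDiagProd (hodgeGroupC Φ₁) (hodgeGroupC Φ₂) := by
  haveI := nonempty_of_finrank_pos₁₂₉ Φ₁ (by omega)
  haveI := nonempty_of_finrank_pos₁₂₉ Φ₂ (by omega)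
  exact hT.hodgeGroupC_prod_eq_blockDiagProd_of_endAlgRat_eq_bot_of_card_sq_le Φ₂ hE₁
    (hT.forall_divisorClasses_eq_hodgeClasses_powPeriod_of_finrank_eq_three_of_endAlgRat_eq_bot h3 hE₁)
    (card_sq_le_of_two_three₁₂₉ Φ₂ h2 h3)

/-- Real points: `Hg(T × S)(ℝ) = Hg(T)(ℝ) × Hg(S)(ℝ)`. [cite: MoonenZarhin1999LowDim, Thm. (0.3) (4) and §3 (3.1)] [cite: Springer1998, §13.3 Cor. 13.3.9 (ii)] -/
theorem IsAbelianVariety.hodgeGroup_prod_eq_of_finrank_eq_three_of_endAlgRat_eq_bot_of_finrank_eq_two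
    (hT : IsAbelianVariety Φ₁) (h3 : finrank ℂ E₁ = 3) (hE₁ : endAlgRat Φ₁ = ⊥) (h2 : finrank ℂ E₂ = 2) :
    hodgeGroup (prodPeriod Φ₁ Φ₂) = ((hodgeGroup Φ₁).prod (hodgeGroup Φ₂)).map (blockDiag ι₁ ι₂) :=
  hodgeGroup_prod_eq_of_hodgeGroupC_prod_eq
    (hT.hodgeGroupC_prod_eq_blockDiagProd_of_finrank_eq_three_of_endAlgRat_eq_bot_of_finrank_eq_two Φ₂ h3 hE₁ h2)

/-- **`dim Hg(T) = 21` and `Lie Hg(T)(ℂ)` simple** for every abelian threefold with `End_ℚ(T) = ℚ` (`Hg(T) = Sp₆`).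
[cite: MoonenZarhin1999LowDim, §2 (2.3) (`g = 3`, Type I(1)) and §3 (p0008 L108–L111)] [cite: Lange2023AbelianVarietiesComplex, §7.3.1 Prop. 7.3.2] -/
theorem IsAbelianVariety.zdim_map_toGL_hodgeGroupC_eq_of_finrank_eq_three_of_endAlgRat_eq_bot (hT : IsAbelianVariety Φ₁)
    (h3 : finrank ℂ E₁ = 3) (hE₁ : endAlgRat Φ₁ = ⊥) :
    (isZConnected_map_toGL_hodgeGroupC Φ₁).zdim = 21 ∧
      LieAlgebra.IsSimple ℂ (lieSubalgebraGL ((hodgeGroupC Φ₁).map Matrix.SpecialLinearGroup.toGL)) := by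
  haveI := nonempty_of_finrank_pos₁₂₉ Φ₁ (by omega)
  have hD := hT.forall_divisorClasses_eq_hodgeClasses_powPeriod_of_finrank_eq_three_of_endAlgRat_eq_bot h3 hE₁
  refine ⟨?_, hT.isSimple_lieSubalgebraGL_map_toGL_hodgeGroupC_of_endAlgRat_eq_bot Φ₁ hE₁ hD⟩
  rw [hT.zdim_map_toGL_hodgeGroupC_eq_of_endAlgRat_eq_bot Φ₁ hE₁ hD, h3]

end Threefold

section Elliptic

variable {ι₁ : Type*} [Fintype ι₁] [DecidableEq ι₁] {E₁ : Type*} [NormedAddCommGroup E₁] [NormedSpace ℂ E₁]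
  [FiniteDimensional ℂ E₁] {Φ₁ : (ι₁ → ℝ) ≃L[ℝ] E₁} {τ : ℂ} (hτ : τ.im ≠ 0)

/-- **`Hg(X₁ × E_τ)(ℂ) = Hg(X₁)(ℂ) × Hg(E_τ)(ℂ)` for every Hodge-general abelian variety `X₁` of dimension `≥ 2`
(`End_ℚ(X₁) = ℚ`, (D) on all powers) and every elliptic curve `E_τ`** (`dim Hg(E_τ) ≤ 3 < 10 ≤ g₁(2g₁+1)`).
[cite: MoonenZarhin1999LowDim, §3 (3.1) and Cor. (3.9)] [cite: Gordon1997, §2.16 Proposition] -/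
theorem IsAbelianVariety.hodgeGroupC_prod_ellipticPeriod_eq_blockDiagProd_of_endAlgRat_eq_bot (hA₁ : IsAbelianVariety Φ₁)
    (hE₁ : endAlgRat Φ₁ = ⊥) (hX₁ : ∀ k p, divisorClasses (powPeriod Φ₁ k) p = hodgeClasses (powPeriod Φ₁ k) p)
    (h2 : 2 ≤ finrank ℂ E₁) :
    hodgeGroupC (prodPeriod Φ₁ (ellipticPeriod hτ)) =
      blockDiagProd (hodgeGroupC Φ₁) (hodgeGroupC (ellipticPeriod hτ)) := by
  haveI := nonempty_of_finrank_pos₁₂₉ Φ₁ (by omega)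
  exact hA₁.hodgeGroupC_prod_eq_blockDiagProd_of_endAlgRat_eq_bot_of_card_sq_le (ellipticPeriod hτ) hE₁ hX₁
    (card_fin_two_sq_le_of_two_le_finrank h2)

/-- **`Hg(T × E_τ)(ℂ) = Hg(T)(ℂ) × Hg(E_τ)(ℂ)` for every abelian threefold `T` with `End_ℚ(T) = ℚ` and every elliptic
curve** — the Hodge-group half of Thm. (0.2)(4) for these fourfolds (not case (a): no `k ↪ End⁰(T) = ℚ`).
[cite: MoonenZarhin1999LowDim, Thm. (0.2) (4) (p0001 L124–L152), §2 (2.3) and §3 (3.1)] [cite: Gordon1997, §2.16 Proposition] -/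
theorem IsAbelianVariety.hodgeGroupC_prod_ellipticPeriod_eq_blockDiagProd_of_finrank_eq_three_of_endAlgRat_eq_bot
    (hT : IsAbelianVariety Φ₁) (h3 : finrank ℂ E₁ = 3) (hE₁ : endAlgRat Φ₁ = ⊥) :
    hodgeGroupC (prodPeriod Φ₁ (ellipticPeriod hτ)) =
      blockDiagProd (hodgeGroupC Φ₁) (hodgeGroupC (ellipticPeriod hτ)) :=
  hT.hodgeGroupC_prod_ellipticPeriod_eq_blockDiagProd_of_endAlgRat_eq_bot hτ hE₁
    (hT.forall_divisorClasses_eq_hodgeClasses_powPeriod_of_finrank_eq_three_of_endAlgRat_eq_bot h3 hE₁) (by omega)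

/-- Real points: `Hg(T × E_τ)(ℝ) = Hg(T)(ℝ) × Hg(E_τ)(ℝ)`. [cite: MoonenZarhin1999LowDim, Thm. (0.2) (4) and §3 (3.1)]
[cite: Springer1998, §13.3 Cor. 13.3.9 (ii)] -/
theorem IsAbelianVariety.hodgeGroup_prod_ellipticPeriod_eq_of_finrank_eq_three_of_endAlgRat_eq_bot
    (hT : IsAbelianVariety Φ₁) (h3 : finrank ℂ E₁ = 3) (hE₁ : endAlgRat Φ₁ = ⊥) :
    hodgeGroup (prodPeriod Φ₁ (ellipticPeriod hτ)) =
      ((hodgeGroup Φ₁).prod (hodgeGroup (ellipticPeriod hτ))).map (blockDiag ι₁ (Fin 2)) :=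
  hodgeGroup_prod_eq_of_hodgeGroupC_prod_eq
    (hT.hodgeGroupC_prod_ellipticPeriod_eq_blockDiagProd_of_finrank_eq_three_of_endAlgRat_eq_bot hτ h3 hE₁)

end Elliptic

end ComplexTorus

end Literature.Geometry.Kaehler

end
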